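import Literature.MathematicalPhysics.QuantumFieldTheory.CentralCircleConfinementD3
import Literature.MathematicalPhysics.QuantumFieldTheory.CentralCircleDominatedWilsonLoops
import Literature.MathematicalPhysics.QuantumFieldTheory.StaticPotentialConcavity
import HarnessLib

/-!
# Logarithmic confinement from the central circle in `d = 3` — the TORUS-STATE form
# (Glimm–Jaffe 1977 / Fröhlich 1979 Cor. 2 / Chatterjee 2026 Thm 3.1 on `(ℤ/Lℤ)³`, uniformly in `L`)

`CentralCircleConfinementD3.lean` PROVES Chatterjee's Theorem 3.1 (arXiv:2602.00436) as printed: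
free boundary conditions in a finite region `Λ ⊆ ℤ³` (the tree's `zdExpect`). The cell's own
currency for Wilson loops is the periodic one — the torus Wilson theory `wilsonExpectation ρ β` of
`ConstructiveQFTWave0` on `(ℤ/Lℤ)^d`, in which `HasAreaLaw`, the centre-domination theorems
(`CentreDominatedWilsonLoops`, `CentralCircleDominatedWilsonLoops`, `ZnCentreDominatedWilsonLoops`)
and the static potential are stated. This file PROVES the same logarithmic bound for the torus
states, uniformly in the side `L` once the loop fits (`4(R+T+1) ≤ L`):

* **`abs_wilsonExpectation_wilsonLoop_le_logConfinement_d3`**: for every compact second-countable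
  `G`, continuous representation `ρ` on `ℂⁿ` (`n ≥ 1`) with unitary values, continuous central
  `ι : U(1) → G` with `ρ(ι(z)) = z·1`, every `β > 0`, torus `(ℤ/Lℤ)³`, base point, plane `i ≠ j`,
  `1 ≤ R`, `T`, with `4(R+T+1) ≤ L`:
  `|⟨W_{R×T}⟩_{G,ρ,β,L}| ≤ exp(−T·log(R+1) / (1890 (1 + nβ)))`.
* `unitaryGroup_wilsonLoop_logConfinement_d3_torus` (`G = U(n)`, fundamental) and
  `u1_wilsonLoop_logConfinement_d3_torus` (`n = 1`: Glimm–Jaffe's three-dimensional `U(1)` theory).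
* The free-parameter form `abs_wilsonExpectation_wilsonLoop_le_exp_d3_torus`
  (`exp(−Tδ log(R+1) + nβ·189 T δ²(1 + log(R+1)))`, `0 ≤ δ ≤ 1`).

**Proof** — the proof of `CentralCircleConfinementD3.lean` transplanted to the torus, where the
expanded model is simpler: the `U(1)` variables are attached to ALL links and distributed by product
Haar measure, so the averaged Haar invariance `∫ g dU = ∫ dU ∫ dζ g(ι(ζ)U)` is the tree's
`integral_eq_integral_integral_circleTwist` (Grosse 1988 (4.131)), and in the background `U` the
`ζ`-system is the phased `U(1)` lattice gauge theory `exp(∑_p J_p(U) Re(u_p(U) ζ_p))`,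
`J_p(U) = β|tr ρ(U_p)| ≤ nβ` (`exp_neg_mul_wilsonAction_circleTwist`). The Glimm–Jaffe /
McBryan–Spencer complex rotation (`Literature.Probability.LatticeModels.abs_integral_reMulChar_mul_complexGinibreWeight_le`,
`CharacterComplexRotationBound.lean`) along `ζ ↦ e^{iτa} ζ` gives, pointwise in `U`,
`|∫ W e^{−βS}| ≤ e^{−a(ℓ)} exp(nβ ∑_p (cosh (da)_p − 1)) ∫ e^{−βS}`. The rotation field `a` is the
logarithmic field `pot` of the `ℤ³` proof PULLED BACK through the chart
`y ↦ (valMinAbs (y_m − x_m))_m` centred at the base point of the loop: since `pot` is supported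
within sup-distance `max(2R, T)` of the base point and `L ≥ 4(R+T+1)`, the chart is additive
wherever `a` or its lattice curl is non-zero, so the loop sum is the `ℤ³` one, `a(ℓ) = Tδ log(R+1)`
(`CentralCircle.tdist_fwd/bwd`), and the plaquette sums are those of `pot` at the charted plaquette
or vanish; the chart being injective on plaquettes, the energy is bounded by the `ℤ³` energy
`∑ (cosh (d pot)_p − 1) ≤ 189 T δ² (1 + log(R+1))` (`CentralCircle.sum_cosh_plaqSum_pot_sub_one_le`,
two-dimensional shells). The constants are those of the `ℤ³` file (`δ = min(1, 1/(945 nβ))`).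

HONEST FRAMING: three-dimensional, central-`U(1)` theories only (`U(n)`, not `SU(n)`); a
logarithmically confining bound on torus Wilson loops at every `β > 0`, uniformly in the volume; it
is not an area law (that needs Göpfert–Mack's `U(1)₃` string tension, Villain action, not in the
tree) and says nothing about four dimensions or the Yang–Mills mass gap.

## References

* S. Chatterjee, *A note on confinement for `U(1)`-centered gauge groups in 3D Wilson lattice gauge
  theory*, arXiv:2602.00436 (2026), Thm 3.1 and §4 (free b.c.; the torus form is the same proof).
  [Chatterjee2026CentralU1]
* J. Glimm, A. Jaffe, *Quark trapping for lattice `U(1)` gauge fields*, Phys. Lett. 66B (1977) 67–69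
  (the complex rotation / logarithmic field). [GlimmJaffe1977QuarkTrapping]
* J. Fröhlich, Phys. Lett. 83B (1979) 195–198, Cor. 2. [Frohlich1979ZN]
* H. Grosse, *Models in Statistical Physics and QFT* (Springer 1988) §4.2.4 (4.131) (the Haar
  substitution). [Grosse1988]
-/

noncomputable section

open MeasureTheory Filter Finset
open Literature.Probability.LatticeModels (expField expField_apply complexGinibreWeight
  phasedGinibreWeight_eq_complexGinibreWeight abs_integral_reMulChar_mul_complexGinibreWeight_le
  complexGinibreWeight_pos box mem_box_iff_supNorm_le)
open Literature.MathematicalPhysics.QuantumLattice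

namespace Literature.MathematicalPhysics.QuantumFieldTheory

namespace CentralCircleTorus

/-! ### 1. Exponential configurations on the torus: holonomies of `e^{iτa}` are exponentials of sums -/

section ExpSums

variable {d L : ℕ}

/-- The sum of a real link function along the straight path of `n` steps in direction `k` from `y`
(torus version of `CentralCircle.lineSum`). [cite: GlimmJaffe1977QuarkTrapping, main estimate (`a(ℓ)`)] -/
def tlineSum (a : Edge d L → ℝ) (k : Fin d) : ℕ → Site d L → ℝ
  | 0, _ => 0
  | n + 1, y => a (y, k) + tlineSum a k n (y.shift k)

/-- The oriented sum of a real link function around the torus plaquette at `y` in the `(k, l)`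
plane (its lattice curl). [cite: GlimmJaffe1977QuarkTrapping, main estimate (`(da)_p`)] -/
def tplaqSum (a : Edge d L → ℝ) (y : Site d L) (k l : Fin d) : ℝ :=
  a (y, k) + a (y.shift k, l) - a (y.shift l, k) - a (y, l)

/-- The oriented sum of a real link function around the rectangular `R × T` torus loop.
[cite: GlimmJaffe1977QuarkTrapping, main estimate (`a(ℓ)`)] -/
def trectSum (a : Edge d L → ℝ) (x : Site d L) (i j : Fin d) (R T : ℕ) : ℝ :=
  tlineSum a i R x + tlineSum a j T (x + Pi.single i (R : ZMod L)) -
    tlineSum a i R (x + Pi.single j (T : ZMod L)) - tlineSum a j T x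

/-- Closed form of the path sum: `∑_{t<n} a(y + t e_k, k)`. [folklore] -/
private theorem tlineSum_eq_sum (a : Edge d L → ℝ) (k : Fin d) :
    ∀ (n : ℕ) (y : Site d L),
      tlineSum a k n y = ∑ t ∈ range n, a (y + Pi.single k ((t : ℕ) : ZMod L), k)
  | 0, _ => by simp [tlineSum]
  | n + 1, y => by
      rw [tlineSum, tlineSum_eq_sum a k n, Finset.sum_range_succ', Nat.cast_zero, Pi.single_zero,
        add_zero, add_comm]
      congr 1
      refine Finset.sum_congr rfl fun t _ => ?_
      rw [Site.shift, add_assoc, ← Pi.single_add, Nat.cast_succ, add_comm (1 : ZMod L)]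

/-- The straight-line holonomy of `e^{iτa}` is `e^{iτ Σ a}`. [folklore] -/
private theorem lineHolonomy_expField (a : Edge d L → ℝ) (τ : ℝ) (k : Fin d) :
    ∀ (n : ℕ) (y : Site d L),
      lineHolonomy (expField a τ) k n y = Circle.exp (τ * tlineSum a k n y)
  | 0, _ => by simp [lineHolonomy, tlineSum]
  | n + 1, y => by
      rw [lineHolonomy, tlineSum, lineHolonomy_expField a τ k n, expField_apply, ← Circle.exp_add,
        mul_add]

/-- The plaquette character of `e^{iτa}` is `e^{iτ (da)_p}`. [cite: GlimmJaffe1977QuarkTrapping, main estimate (`θ_p ↦ θ_p + i(da)_p`)] -/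
theorem u1PlaquetteChars_expField (a : Edge d L → ℝ) (τ : ℝ) (p : Plaquette d L) :
    u1PlaquetteChars d L p (expField a τ) = Circle.exp (τ * tplaqSum a p.1 p.2.1.1 p.2.1.2) := by
  change plaquetteHolonomy (expField a τ) p.1 p.2.1.1 p.2.1.2 = _
  simp only [plaquetteHolonomy, expField_apply, tplaqSum, mul_add, mul_sub, Circle.exp_add,
    Circle.exp_sub, div_eq_mul_inv]

/-- The loop character of `e^{iτa}` is `e^{iτ a(ℓ)}`. [cite: GlimmJaffe1977QuarkTrapping, main estimate (`W(C) ↦ e^{-a(C)} W(C)`)] -/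
theorem u1RectChar_expField (a : Edge d L → ℝ) (τ : ℝ) (x : Site d L) (i j : Fin d) (R T : ℕ) :
    u1RectChar x i j R T (expField a τ) = Circle.exp (τ * trectSum a x i j R T) := by
  change rectangleHolonomy (expField a τ) x i j R T = _
  simp only [rectangleHolonomy, lineHolonomy_expField, trectSum, mul_add, mul_sub, Circle.exp_add,
    Circle.exp_sub, div_eq_mul_inv]

end ExpSums

/-! ### 2. The chart centred at the base point and the pulled-back rotation field -/

section Chart

variable {L : ℕ} (x : Site 3 L) (i j : Fin 3) (R T : ℕ) (δ : ℝ)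

/-- The chart of the torus centred at `x`: the representative of `y − x` with coordinates in
`(−L/2, L/2]` (`ZMod.valMinAbs`), a point of `ℤ³`. [folklore] -/
def chart (y : Site 3 L) : Literature.Probability.LatticeModels.Site 3 :=
  fun m => ZMod.valMinAbs (y m - x m)

/-- The Glimm–Jaffe rotation field of the torus loop: the logarithmic field `CentralCircle.pot` of
the `ℤ³` loop based at `0`, pulled back through the chart. [cite: GlimmJaffe1977QuarkTrapping, main estimate (logarithmic rotation field)] -/
def tpot : Edge 3 L → ℝ := fun e => CentralCircle.pot 0 i j R T δ (chart x e.1, e.2)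

variable {x i j R T δ}

/-- The chart sends the base point to the origin. [folklore] -/
private theorem chart_self : chart x x = 0 := by
  funext m; simp [chart, ZMod.valMinAbs_zero]

/-- The chart is injective. [folklore] -/
private theorem chart_injective : Function.Injective (chart x) := by
  intro y y' h
  funext m
  have hm := congrFun h m
  simp only [chart] at hm
  have := ZMod.valMinAbs_inj.1 hm
  simpa using this

/-- Every chart coordinate is at most `L/2` in absolute value. [folklore] -/
private theorem natAbs_chart_le [NeZero L] (y : Site 3 L) (m : Fin 3) : (chart x y m).natAbs ≤ L / 2 :=
  ZMod.natAbs_valMinAbs_le _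

/-- **Additivity of the chart below the seam**: if the `m`-th chart coordinate of `y` satisfies
`2 c + 2 ≤ L`, the chart of `y + e_m` is the chart of `y` plus `e_m`. [folklore] -/
private theorem chart_shift [NeZero L] {y : Site 3 L} {m : Fin 3} (h : chart x y m * 2 + 2 ≤ (L : ℤ)) :
    chart x (y.shift m) = chart x y + Pi.single m (1 : ℤ) := by
  funext m'
  by_cases hm : m' = m
  · subst hm
    simp only [chart, Site.shift, Pi.add_apply, Pi.single_eq_same]
    have hv := (ZMod.valMinAbs_mem_Ioc (y m' - x m')).1
    refine (ZMod.valMinAbs_spec _ _).2 ⟨?_, ?_, ?_⟩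
    · push_cast [ZMod.coe_valMinAbs]; ring
    · linarith
    · simp only [chart] at h; linarith
  · simp [chart, Site.shift, Pi.single_eq_of_ne hm]

/-- **Additivity of the chart above the lower seam** (backward form): if the `m`-th chart coordinate
`c` of `y + e_m` satisfies `−L < 2(c − 1)`, the chart of `y` is the chart of `y + e_m` minus `e_m`. [folklore] -/
private theorem chart_of_shift [NeZero L] {y : Site 3 L} {m : Fin 3}
    (h : -(L : ℤ) < (chart x (y.shift m) m - 1) * 2) :
    chart x y = chart x (y.shift m) - Pi.single m (1 : ℤ) := by
  funext m'
  by_cases hm : m' = m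
  · subst hm
    simp only [chart, Site.shift, Pi.add_apply, Pi.sub_apply, Pi.single_eq_same]
    have hv := (ZMod.valMinAbs_mem_Ioc (y m' + 1 - x m')).2
    refine (ZMod.valMinAbs_spec _ _).2 ⟨?_, ?_, ?_⟩
    · push_cast [ZMod.coe_valMinAbs]; ring
    · simp only [chart, Site.shift, Pi.add_apply, Pi.single_eq_same] at h; linarith
    · linarith
  · simp [chart, Site.shift, Pi.single_eq_of_ne hm]

/-- Along the rectangle the chart is the obvious one: `chart(x + s eᵢ + t eⱼ) = s eᵢ + t eⱼ` for
`i ≠ j`, `2s ≤ L`, `2t ≤ L`. [folklore] -/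
private theorem chart_path [NeZero L] (hij : i ≠ j) {s t : ℕ} (hs : s ≤ L / 2) (ht : t ≤ L / 2) :
    chart x (x + Pi.single i ((s : ℕ) : ZMod L) + Pi.single j ((t : ℕ) : ZMod L)) =
      Pi.single i (s : ℤ) + Pi.single j (t : ℤ) := by
  funext m
  simp only [chart, Pi.add_apply]
  by_cases hmi : m = i
  · subst hmi
    rw [Pi.single_eq_same, Pi.single_eq_same, Pi.single_eq_of_ne hij, Pi.single_eq_of_ne hij,
      add_zero, add_zero, add_sub_cancel_left]
    exact_mod_cast ZMod.valMinAbs_natCast_of_le_half hs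
  · by_cases hmj : m = j
    · subst hmj
      rw [Pi.single_eq_same, Pi.single_eq_same, Pi.single_eq_of_ne hmi, Pi.single_eq_of_ne hmi,
        add_zero, zero_add, add_sub_cancel_left]
      exact_mod_cast ZMod.valMinAbs_natCast_of_le_half ht
    · rw [Pi.single_eq_of_ne hmi, Pi.single_eq_of_ne hmj, Pi.single_eq_of_ne hmi,
        Pi.single_eq_of_ne hmj, add_zero, add_zero, add_zero, sub_self, ZMod.valMinAbs_zero]

/-- **Support of the rotation field**: where `pot 0 i j R T δ (w, k)` is non-zero, every coordinate
of `w` is at most `max(2R, T)` in absolute value (`k = j`, height `0 ≤ w_j < T`, transverse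
sup-distance `< R` to the column through `R eᵢ`). [cite: GlimmJaffe1977QuarkTrapping, main estimate (support of the rotation field)] -/
theorem natAbs_le_of_pot_ne_zero {w : Literature.Probability.LatticeModels.Site 3} {k : Fin 3}
    (h : CentralCircle.pot 0 i j R T δ (w, k) ≠ 0) (m : Fin 3) : (w m).natAbs ≤ max (2 * R) T := by
  unfold CentralCircle.pot at h
  split_ifs at h with hc
  · obtain ⟨-, h0, hT⟩ := hc
    simp only [Pi.zero_apply, sub_zero] at h0 hT
    -- the transverse distance is `< R`
    have hd : CentralCircle.tdist 0 i j R w < R := by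
      by_contra hge
      apply h
      simp [CentralCircle.logPot, min_eq_right (not_lt.1 hge)]
    by_cases hmj : m = j
    · subst hmj
      have : (w m).natAbs ≤ T := by
        have h1 : ((w m).natAbs : ℤ) = w m := Int.natAbs_of_nonneg h0
        omega
      exact this.trans (le_max_right _ _)
    · -- a transverse coordinate: bounded through `tdist`
      obtain ⟨a, ha⟩ := Fin.exists_succAbove_eq hmj
      have hle : ((w - CentralCircle.fwdBase 0 i R) m).natAbs ≤ CentralCircle.tdist 0 i j R w := by
        have := Literature.Probability.LatticeModels.Site.natAbs_le_supNorm
          (CentralCircle.transverse j (w - CentralCircle.fwdBase 0 i R)) a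
        have e : CentralCircle.transverse j (w - CentralCircle.fwdBase 0 i R) a =
            (w - CentralCircle.fwdBase 0 i R) m := by rw [← ha]; rfl
        rw [e] at this
        exact this
      have hlt : ((w - CentralCircle.fwdBase 0 i R) m).natAbs < R := lt_of_le_of_lt hle hd
      simp only [CentralCircle.fwdBase, Pi.sub_apply, zero_add] at hlt
      by_cases hmi : m = i
      · subst hmi
        rw [Pi.single_eq_same] at hlt
        have : (w m).natAbs ≤ 2 * R := by omega
        exact this.trans (le_max_left _ _)
      · rw [Pi.single_eq_of_ne hmi, sub_zero] at hlt
        have : (w m).natAbs ≤ 2 * R := by omega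
        exact this.trans (le_max_left _ _)
  · exact absurd rfl h

end Chart


/-! ### 3. The gain `a(ℓ) = Tδ log(R+1)` and the energy `∑_p (cosh (da)_p − 1) ≤ 189 T δ² (1 + log(R+1))` on the torus -/

section Geometry

variable {L : ℕ} [NeZero L] {x : Site 3 L} {i j : Fin 3} {R T : ℕ} {δ : ℝ}

/-- `|c| ≤ M` for a natural `M` unfolds to `−M ≤ c ≤ M`. [folklore] -/
private theorem bounds_of_natAbs_le {c : ℤ} {M : ℕ} (h : c.natAbs ≤ M) : -(M : ℤ) ≤ c ∧ c ≤ M := by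
  have : |c| ≤ (M : ℤ) := by rw [Int.abs_eq_natAbs]; exact_mod_cast h
  exact abs_le.1 this

/-- `|(e_k)_a| ≤ 1`. [folklore] -/
private theorem natAbs_single_one_le (k a : Fin 3) :
    ((Pi.single k (1 : ℤ) : Fin 3 → ℤ) a).natAbs ≤ 1 := by
  by_cases h : a = k
  · subst h; simp
  · simp [Pi.single_eq_of_ne h]

/-- **The plaquette sums of the pulled-back field are those of the `ℤ³` field at the charted
plaquette, or vanish** (for `L ≥ 4(R+T+1)`: the chart is additive on the `1`-neighbourhood of
the support). [cite: GlimmJaffe1977QuarkTrapping, main estimate (energy of the rotation field)] -/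
theorem tplaqSum_tpot_eq_or (hL : 4 * (R + T + 1) ≤ L) (y : Site 3 L) (k l : Fin 3) :
    tplaqSum (tpot x i j R T δ) y k l =
        CentralCircle.plaqSum (CentralCircle.pot 0 i j R T δ) (chart x y) k l ∨
      tplaqSum (tpot x i j R T δ) y k l = 0 := by
  have hM1 : 2 * R ≤ max (2 * R) T := le_max_left _ _
  have hM2 : T ≤ max (2 * R) T := le_max_right _ _
  have hM3 : max (2 * R) T ≤ 2 * R + T := max_le (by omega) (by omega)
  by_cases hall : tpot x i j R T δ (y, k) = 0 ∧ tpot x i j R T δ (y.shift k, l) = 0 ∧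
      tpot x i j R T δ (y.shift l, k) = 0 ∧ tpot x i j R T δ (y, l) = 0
  · right
    rw [tplaqSum, hall.1, hall.2.1, hall.2.2.1, hall.2.2.2]
    ring
  · left
    -- all chart coordinates of `y` are at most `max(2R,T) + 1`
    have hM : ∀ m, -((max (2 * R) T : ℕ) : ℤ) - 1 ≤ chart x y m ∧
        chart x y m ≤ ((max (2 * R) T : ℕ) : ℤ) + 1 := by
      simp only [not_and_or] at hall
      -- from a non-zero value at a SHIFTED base point, go back to `y`
      have back : ∀ m₀ : Fin 3, tpot x i j R T δ (y.shift m₀, if m₀ = k then l else k) ≠ 0 →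
          ∀ m, -((max (2 * R) T : ℕ) : ℤ) - 1 ≤ chart x y m ∧
            chart x y m ≤ ((max (2 * R) T : ℕ) : ℤ) + 1 := by
        intro m₀ h m
        have hb := fun m' => bounds_of_natAbs_le (natAbs_le_of_pot_ne_zero h m')
        have hback : chart x y = chart x (y.shift m₀) - Pi.single m₀ (1 : ℤ) :=
          chart_of_shift (by have := (hb m₀).1; push_cast at this ⊢; omega)
        rw [hback, Pi.sub_apply]
        have := hb m
        have h1 := bounds_of_natAbs_le (natAbs_single_one_le m₀ m)
        push_cast at this h1 ⊢
        omega
      intro m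
      rcases hall with h | h | h | h
      · have := bounds_of_natAbs_le (natAbs_le_of_pot_ne_zero h m); push_cast at this ⊢; omega
      · exact back k (by simpa using h) m
      · by_cases hlk : l = k
        · subst hlk; exact back l (by simpa using h) m
        · exact back l (by simpa [hlk] using h) m
      · have := bounds_of_natAbs_le (natAbs_le_of_pot_ne_zero h m); push_cast at this ⊢; omega
    have hLz : (4 * (R + T + 1) : ℤ) ≤ L := by exact_mod_cast hL
    have hk : chart x (y.shift k) = chart x y + Pi.single k 1 :=
      chart_shift (by have := (hM k).2; push_cast at this; omega)
    have hl : chart x (y.shift l) = chart x y + Pi.single l 1 :=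
      chart_shift (by have := (hM l).2; push_cast at this; omega)
    simp only [tplaqSum, tpot, CentralCircle.plaqSum, hk, hl]

/-- **The energy of the rotation field on the torus** is at most that of the `ℤ³` field:
`∑_{p ∈ 𝕋³_L} (cosh (da)_p − 1) ≤ 189 T δ² (1 + log(R+1))` for `0 ≤ δ ≤ 1`, `L ≥ 4(R+T+1)` (the
chart is injective on plaquettes; two-dimensional shells, `CentralCircle.sum_cosh_plaqSum_pot_sub_one_le`).
[cite: GlimmJaffe1977QuarkTrapping, main estimate (energy of the rotation field)] -/
theorem sum_cosh_tplaqSum_tpot_sub_one_le (hij : i ≠ j) (hδ0 : 0 ≤ δ) (hδ1 : δ ≤ 1)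
    (hL : 4 * (R + T + 1) ≤ L) :
    ∑ p : Plaquette 3 L, (Real.cosh (tplaqSum (tpot x i j R T δ) p.1 p.2.1.1 p.2.1.2) - 1) ≤
      189 * T * δ ^ 2 * (1 + Real.log (R + 1)) := by
  classical
  set Λt : Finset (Literature.Probability.LatticeModels.Site 3) := box 3 (L / 2 + 2) with hΛt
  set Φ : Plaquette 3 L → Literature.Probability.LatticeModels.Site 3 × Fin 3 × Fin 3 :=
    fun p => (chart x p.1, p.2.1.1, p.2.1.2) with hΦ
  set g : Literature.Probability.LatticeModels.Site 3 × Fin 3 × Fin 3 → ℝ := fun q =>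
    Real.cosh (CentralCircle.plaqSum (CentralCircle.pot 0 i j R T δ) q.1 q.2.1 q.2.2) - 1 with hg
  have hg0 : ∀ q, 0 ≤ g q := fun q => sub_nonneg.2 (Real.one_le_cosh _)
  -- termwise comparison
  have h1 : ∀ p : Plaquette 3 L,
      Real.cosh (tplaqSum (tpot x i j R T δ) p.1 p.2.1.1 p.2.1.2) - 1 ≤ g (Φ p) := by
    intro p
    rcases tplaqSum_tpot_eq_or (x := x) (δ := δ) hL p.1 p.2.1.1 p.2.1.2 with h | h
    · rw [h]
    · rw [h, Real.cosh_zero, sub_self]; exact hg0 _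
  -- the chart is injective on plaquettes
  have hΦi : Function.Injective Φ := by
    rintro ⟨y, ⟨⟨k, l⟩, hkl⟩⟩ ⟨y', ⟨⟨k', l'⟩, hkl'⟩⟩ h
    simp only [hΦ, Prod.mk.injEq] at h
    obtain ⟨hy, hk, hl'⟩ := h
    have hyy := chart_injective hy
    subst hyy; subst hk; subst hl'
    rfl
  -- its image consists of plaquettes of the box `Λt`
  have hbox : ∀ (y : Site 3 L) (v : Literature.Probability.LatticeModels.Site 3),
      (∀ a, (v a).natAbs ≤ 2) → chart x y + v ∈ Λt := by
    intro y v hv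
    rw [hΛt, mem_box_iff_supNorm_le, Literature.Probability.LatticeModels.Site.supNorm_le_iff]
    intro a
    rw [Pi.add_apply]
    exact (Int.natAbs_add_le _ _).trans (Nat.add_le_add (natAbs_chart_le y a) (hv a))
  have himg : univ.image Φ ⊆ plaquettesIn Λt := by
    intro q hq
    obtain ⟨p, -, rfl⟩ := mem_image.1 hq
    simp only [plaquettesIn, mem_filter, mem_product, mem_univ, and_true, hΦ]
    refine ⟨?_, p.2.2, ?_, ?_, ?_⟩
    · simpa using hbox p.1 0 (fun a => by simp)
    · exact hbox p.1 _ fun a => (natAbs_single_one_le _ a).trans one_le_two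
    · exact hbox p.1 _ fun a => (natAbs_single_one_le _ a).trans one_le_two
    · rw [add_assoc]
      exact hbox p.1 _ fun a => by
        rw [Pi.add_apply]
        exact (Int.natAbs_add_le _ _).trans
          (Nat.add_le_add (natAbs_single_one_le _ a) (natAbs_single_one_le _ a))
  calc ∑ p : Plaquette 3 L, (Real.cosh (tplaqSum (tpot x i j R T δ) p.1 p.2.1.1 p.2.1.2) - 1)
      ≤ ∑ p : Plaquette 3 L, g (Φ p) := sum_le_sum fun p _ => h1 p
    _ = ∑ q ∈ univ.image Φ, g q := (sum_image fun p _ p' _ h => hΦi h).symm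
    _ ≤ ∑ q ∈ plaquettesIn Λt, g q := sum_le_sum_of_subset_of_nonneg himg fun q _ _ => hg0 q
    _ ≤ _ := CentralCircle.sum_cosh_plaqSum_pot_sub_one_le hij hδ0 hδ1 Λt

/-- **The gain on the torus**: the pulled-back rotation field sums to `Tδ log(R+1)` around the
loop (`L ≥ 4(R+T+1)`: the chart is the identity along the loop). [cite: GlimmJaffe1977QuarkTrapping, main estimate (the factor `e^{-a(C)}`)] -/
theorem trectSum_tpot (hij : i ≠ j) (hL : 4 * (R + T + 1) ≤ L) :
    trectSum (tpot x i j R T δ) x i j R T = T * (δ * Real.log (R + 1)) := by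
  have hR2 : R ≤ L / 2 := by omega
  -- the field vanishes on `i`-links
  have hi0 : ∀ y : Site 3 L, tpot x i j R T δ (y, i) = 0 := fun y => by
    simp [tpot, CentralCircle.pot, hij]
  have hline : ∀ (n : ℕ) (y : Site 3 L), tlineSum (tpot x i j R T δ) i n y = 0 := fun n y => by
    rw [tlineSum_eq_sum]; exact sum_eq_zero fun t _ => hi0 _
  -- the forward `j`-side: each link carries `δ log(R+1)`
  have hfwd : tlineSum (tpot x i j R T δ) j T (x + Pi.single i ((R : ℕ) : ZMod L)) =
      T * (δ * Real.log (R + 1)) := by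
    rw [tlineSum_eq_sum]
    have hterm : ∀ t ∈ range T, tpot x i j R T δ
        (x + Pi.single i ((R : ℕ) : ZMod L) + Pi.single j ((t : ℕ) : ZMod L), j) =
          δ * Real.log (R + 1) := by
      intro t ht
      have htT := mem_range.1 ht
      have hfw := CentralCircle.tdist_fwd (x := (0 : Literature.Probability.LatticeModels.Site 3))
        (i := i) (j := j) (R := R) t
      simp only [CentralCircle.fwdBase, zero_add] at hfw
      simp only [tpot, chart_path hij hR2 (by omega : t ≤ L / 2)]
      simp only [CentralCircle.pot, true_and, Pi.add_apply, Pi.single_eq_same,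
        Pi.single_eq_of_ne' hij, Pi.zero_apply, sub_zero, zero_add, hfw]
      rw [if_pos ⟨by positivity, by exact_mod_cast htT⟩]
      simp [CentralCircle.logPot]
    rw [sum_congr rfl hterm, sum_const, card_range, nsmul_eq_mul]
  -- the backward `j`-side: transverse distance `R`, the potential vanishes
  have hbwd : tlineSum (tpot x i j R T δ) j T x = 0 := by
    rw [tlineSum_eq_sum]
    refine sum_eq_zero fun t ht => ?_
    have htT := mem_range.1 ht
    have hbw := CentralCircle.tdist_bwd (x := (0 : Literature.Probability.LatticeModels.Site 3))
      (R := R) hij t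
    simp only [zero_add] at hbw
    have hx : x + Pi.single j ((t : ℕ) : ZMod L) =
        x + Pi.single i ((0 : ℕ) : ZMod L) + Pi.single j ((t : ℕ) : ZMod L) := by
      simp
    rw [hx, tpot, chart_path hij (Nat.zero_le _) (by omega : t ≤ L / 2)]
    simp only [Nat.cast_zero, Pi.single_zero, zero_add]
    simp only [CentralCircle.pot]
    split_ifs
    · rw [hbw]; simp [CentralCircle.logPot]
    · rfl
  rw [trectSum, hline, hline, hfwd, hbwd]
  ring

end Geometry


/-! ### 4. Assembly on the torus: Haar substitution, rotation bound in the background, Fubini -/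

section Assembly

variable {L n : ℕ} [NeZero L] {G : Type*} [Group G] [TopologicalSpace G] [IsTopologicalGroup G]
  [CompactSpace G] [MeasurableSpace G] [BorelSpace G]
  (ρ : G →* Matrix (Fin n) (Fin n) ℂ) (ι : Circle →* G)

/-- `‖tr M‖ ≤ n` for a unitary `n × n` matrix. [folklore] -/
private theorem norm_trace_le_of_mem_unitaryGroup {M : Matrix (Fin n) (Fin n) ℂ}
    (hM : M ∈ Matrix.unitaryGroup (Fin n) ℂ) : ‖M.trace‖ ≤ n := by
  calc ‖M.trace‖ = ‖∑ a, M a a‖ := rfl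
    _ ≤ ∑ a, ‖M a a‖ := norm_sum_le _ _
    _ ≤ ∑ _a : Fin n, (1 : ℝ) := Finset.sum_le_sum fun a _ => entry_norm_bound_of_unitary hM a a
    _ = n := by simp

omit [NeZero L] [CompactSpace G] [MeasurableSpace G] [BorelSpace G] in
/-- The circle twist is jointly continuous. [folklore] -/
private theorem continuous_circleTwist_prod (hιc : Continuous ι) :
    Continuous fun p : GaugeConfig 3 L G × GaugeConfig 3 L Circle => circleTwist ι p.2 p.1 :=
  continuous_pi fun e =>
    (hιc.comp ((continuous_apply e).comp continuous_snd)).mul ((continuous_apply e).comp continuous_fst)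

variable {ρ ι}

omit [TopologicalSpace G] [IsTopologicalGroup G] [CompactSpace G] [MeasurableSpace G] [BorelSpace G] in
/-- **The rotation bound in the background `U`** (Glimm–Jaffe / McBryan–Spencer complex rotation of
the `U(1)` variables `ζ ↦ e^{iτa}ζ`, for ANY real link field `a`): with unitary-valued `ρ`, central `ι`
acting by scalars in `ρ` and `β ≥ 0`,
`|∫ W(ι(ζ)U) e^{−βS(ι(ζ)U)} dζ| ≤ e^{−a(ℓ)} · exp(nβ ∑_p (cosh (da)_p − 1)) · ∫ e^{−βS(ι(ζ)U)} dζ`.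
[cite: GlimmJaffe1977QuarkTrapping, main estimate (complex rotation of the `U(1)` variables)] -/
theorem abs_integral_circleTwist_le (hι : ∀ z, ι z ∈ Subgroup.center G)
    (hρι : ∀ z, ρ (ι z) = (z : ℂ) • (1 : Matrix (Fin n) (Fin n) ℂ))
    (hρu : ∀ g, ρ g ∈ Matrix.unitaryGroup (Fin n) ℂ) {β : ℝ} (hβ : 0 ≤ β)
    (U : GaugeConfig 3 L G) (a : Edge 3 L → ℝ) (x : Site 3 L) (i j : Fin 3) (R T : ℕ) :
    |∫ ζ, wilsonLoop ρ x i j R T (circleTwist ι ζ U) *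
        Real.exp (-β * wilsonAction ρ (circleTwist ι ζ U))
          ∂(Measure.pi fun _ : Edge 3 L => haarProbability Circle)| ≤
      Real.exp (-trectSum a x i j R T) *
        Real.exp (n * β * ∑ p : Plaquette 3 L, (Real.cosh (tplaqSum a p.1 p.2.1.1 p.2.1.2) - 1)) *
        ∫ ζ, Real.exp (-β * wilsonAction ρ (circleTwist ι ζ U))
          ∂(Measure.pi fun _ : Edge 3 L => haarProbability Circle) := by
  set πU : Measure (GaugeConfig 3 L Circle) := Measure.pi fun _ : Edge 3 L => haarProbability Circle
    with hπU
  set χ := u1PlaquetteChars 3 L with hχ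
  set χ₀ := u1RectChar (d := 3) (L := L) x i j R T with hχ₀
  set K : Plaquette 3 L → ℂ := fun p => ((bgCoupling ρ β U p : ℝ) : ℂ) * ((bgPhase ρ U p : Circle) : ℂ)
    with hK
  set e₀ : ℝ := Real.exp (-β * ((n : ℝ) * Fintype.card (Plaquette 3 L))) with he₀
  set t : ℂ := (ρ (rectangleHolonomy U x i j R T)).trace with ht
  have he₀pos : 0 < e₀ := Real.exp_pos _
  -- the integrands in the background `U`
  have hw : ∀ ζ, Real.exp (-β * wilsonAction ρ (circleTwist ι ζ U)) = e₀ * complexGinibreWeight χ K ζ :=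
    fun ζ => by
      rw [exp_neg_mul_wilsonAction_circleTwist hι hρι β ζ U, phasedGinibreWeight_eq_complexGinibreWeight]
  have hX : ∀ ζ, wilsonLoop ρ x i j R T (circleTwist ι ζ U) = (n : ℝ)⁻¹ * (t * ((χ₀ ζ : Circle) : ℂ)).re :=
    fun ζ => wilsonLoop_circleTwist hι hρι ζ x i j R T U
  have e1 : ∀ ζ, wilsonLoop ρ x i j R T (circleTwist ι ζ U) * Real.exp (-β * wilsonAction ρ (circleTwist ι ζ U)) =
      ((n : ℝ)⁻¹ * e₀) * ((t * ((χ₀ ζ : Circle) : ℂ)).re * complexGinibreWeight χ K ζ) := fun ζ => by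
    rw [hX, hw]; ring
  simp_rw [e1, hw, integral_const_mul]
  -- the complex rotation along `expField a`
  have hγ : ∀ (p : Plaquette 3 L) (τ : ℝ), χ p (expField a τ) =
      Circle.exp (τ * tplaqSum a p.1 p.2.1.1 p.2.1.2) := fun p τ => u1PlaquetteChars_expField a τ p
  have hγ₀ : ∀ τ : ℝ, χ₀ (expField a τ) = Circle.exp (τ * trectSum a x i j R T) := fun τ =>
    u1RectChar_expField a τ x i j R T
  have hMS := abs_integral_reMulChar_mul_complexGinibreWeight_le πU (K := K) hγ hγ₀ t
  -- `‖K_p‖ = J_p(U) ≤ nβ`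
  have hKn : ∀ p, ‖K p‖ = bgCoupling ρ β U p := fun p => by
    rw [hK]
    dsimp only
    rw [norm_mul, Complex.norm_real, Circle.norm_coe, mul_one, Real.norm_eq_abs,
      abs_of_nonneg (bgCoupling_nonneg hβ U p)]
  have hsum : ∑ p, ‖K p‖ * (Real.cosh (tplaqSum a p.1 p.2.1.1 p.2.1.2) - 1) ≤
      n * β * ∑ p : Plaquette 3 L, (Real.cosh (tplaqSum a p.1 p.2.1.1 p.2.1.2) - 1) := by
    rw [Finset.mul_sum]
    exact Finset.sum_le_sum fun p _ => by
      rw [hKn]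
      exact mul_le_mul_of_nonneg_right (bgCoupling_le hρu hβ U p) (sub_nonneg.2 (Real.one_le_cosh _))
  have htn : ‖t‖ ≤ n := norm_trace_le_of_mem_unitaryGroup (hρu _)
  have hZ : 0 ≤ ∫ ζ, complexGinibreWeight χ K ζ ∂πU :=
    integral_nonneg fun ζ => (complexGinibreWeight_pos χ K ζ).le
  have hn0 : (0 : ℝ) ≤ (n : ℝ)⁻¹ := by positivity
  have hnn : (n : ℝ)⁻¹ * n ≤ 1 := by
    rcases Nat.eq_zero_or_pos n with h | h
    · simp [h]
    · rw [inv_mul_cancel₀ (by positivity)]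
  rw [abs_mul, abs_of_nonneg (mul_nonneg hn0 he₀pos.le)]
  calc (n : ℝ)⁻¹ * e₀ * |∫ ζ, (t * ((χ₀ ζ : Circle) : ℂ)).re * complexGinibreWeight χ K ζ ∂πU|
      ≤ (n : ℝ)⁻¹ * e₀ * (‖t‖ * Real.exp (-trectSum a x i j R T) *
          Real.exp (∑ p, ‖K p‖ * (Real.cosh (tplaqSum a p.1 p.2.1.1 p.2.1.2) - 1)) *
          ∫ ζ, complexGinibreWeight χ K ζ ∂πU) := by gcongr
    _ ≤ (n : ℝ)⁻¹ * e₀ * ((n : ℝ) * Real.exp (-trectSum a x i j R T) *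
          Real.exp (n * β * ∑ p : Plaquette 3 L, (Real.cosh (tplaqSum a p.1 p.2.1.1 p.2.1.2) - 1)) *
          ∫ ζ, complexGinibreWeight χ K ζ ∂πU) := by gcongr
    _ = ((n : ℝ)⁻¹ * n) * (Real.exp (-trectSum a x i j R T) *
          Real.exp (n * β * ∑ p : Plaquette 3 L, (Real.cosh (tplaqSum a p.1 p.2.1.1 p.2.1.2) - 1)) *
          (e₀ * ∫ ζ, complexGinibreWeight χ K ζ ∂πU)) := by ring
    _ ≤ 1 * (Real.exp (-trectSum a x i j R T) *
          Real.exp (n * β * ∑ p : Plaquette 3 L, (Real.cosh (tplaqSum a p.1 p.2.1.1 p.2.1.2) - 1)) *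
          (e₀ * ∫ ζ, complexGinibreWeight χ K ζ ∂πU)) := by gcongr
    _ = _ := one_mul _

variable [SecondCountableTopology G]

/-- Integrability of the inner `ζ`-averages as functions of the background. [folklore] -/
private theorem integrable_integral_circleTwist' (hιc : Continuous ι) {g : GaugeConfig 3 L G → ℝ}
    (hg : Continuous g) :
    Integrable (fun U => ∫ ζ, g (circleTwist ι ζ U) ∂(Measure.pi fun _ : Edge 3 L => haarProbability Circle))
      (Measure.pi fun _ : Edge 3 L => haarProbability G) := by
  set F : GaugeConfig 3 L G × GaugeConfig 3 L Circle → ℝ := fun p => g (circleTwist ι p.2 p.1) with hF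
  have hFc : Continuous F := hg.comp (continuous_circleTwist_prod ι hιc)
  have hFi : Integrable F ((Measure.pi fun _ : Edge 3 L => haarProbability G).prod
      (Measure.pi fun _ : Edge 3 L => haarProbability Circle)) :=
    Literature.Probability.LatticeModels.integrable_of_continuous_compactSpace _ hFc
  exact hFi.integral_prod_left

/-- **The torus bound with a free rotation parameter `δ`**: for `0 ≤ δ ≤ 1`, `i ≠ j` and
`4(R+T+1) ≤ L`, `|⟨W_{R×T}⟩_{G,ρ,β,L}| ≤ exp(−Tδ log(R+1) + nβ · 189 T δ² (1 + log(R+1)))`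
(averaged Haar invariance `integral_eq_integral_integral_circleTwist`, the pointwise rotation bound
`abs_integral_circleTwist_le` with the pulled-back logarithmic field, the gain `trectSum_tpot` and the
energy `sum_cosh_tplaqSum_tpot_sub_one_le`). [cite: GlimmJaffe1977QuarkTrapping, main estimate (before optimising the rotation field)] [cite: Chatterjee2026CentralU1, §4 (proof of Thm 3.1)] -/
theorem abs_wilsonExpectation_wilsonLoop_le_exp_d3_torus (hρ : Continuous ρ)
    (hρu : ∀ g, ρ g ∈ Matrix.unitaryGroup (Fin n) ℂ) (hιc : Continuous ι)
    (hι : ∀ z, ι z ∈ Subgroup.center G)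
    (hρι : ∀ z, ρ (ι z) = (z : ℂ) • (1 : Matrix (Fin n) (Fin n) ℂ)) {β : ℝ} (hβ : 0 ≤ β)
    (x : Site 3 L) {i j : Fin 3} (hij : i ≠ j) {R T : ℕ} (hL : 4 * (R + T + 1) ≤ L)
    {δ : ℝ} (hδ0 : 0 ≤ δ) (hδ1 : δ ≤ 1) :
    |wilsonExpectation ρ β (wilsonLoop ρ x i j R T)| ≤
      Real.exp (-(T * (δ * Real.log (R + 1))) + n * β * (189 * T * δ ^ 2 * (1 + Real.log (R + 1)))) := by
  set πG : Measure (GaugeConfig 3 L G) := Measure.pi fun _ : Edge 3 L => haarProbability G with hπG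
  set πU : Measure (GaugeConfig 3 L Circle) := Measure.pi fun _ : Edge 3 L => haarProbability Circle
    with hπU
  set a : Edge 3 L → ℝ := tpot x i j R T δ with ha
  set X : GaugeConfig 3 L G → ℝ := wilsonLoop ρ x i j R T with hX
  set w : GaugeConfig 3 L G → ℝ := fun U => Real.exp (-β * wilsonAction ρ U) with hw
  have hXc : Continuous X := continuous_wilsonLoop ρ hρ x i j R T
  have hwc : Continuous w :=
    Real.continuous_exp.comp (continuous_const.mul (continuous_wilsonAction ρ hρ))
  have hXwc : Continuous fun U => X U * w U := hXc.mul hwc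
  -- the bound `B`
  set B : ℝ := Real.exp (-trectSum a x i j R T) *
    Real.exp (n * β * ∑ p : Plaquette 3 L, (Real.cosh (tplaqSum a p.1 p.2.1.1 p.2.1.2) - 1)) with hB
  have hBle : B ≤ Real.exp (-(T * (δ * Real.log (R + 1))) +
      n * β * (189 * T * δ ^ 2 * (1 + Real.log (R + 1)))) := by
    rw [hB, ← Real.exp_add, Real.exp_le_exp, ha, trectSum_tpot hij hL]
    have := sum_cosh_tplaqSum_tpot_sub_one_le (x := x) (δ := δ) hij hδ0 hδ1 hL
    have hnb : (0 : ℝ) ≤ n * β := by positivity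
    nlinarith
  -- pointwise in the background
  have hpt : ∀ U, |∫ ζ, X (circleTwist ι ζ U) * w (circleTwist ι ζ U) ∂πU| ≤
      B * ∫ ζ, w (circleTwist ι ζ U) ∂πU := fun U =>
    abs_integral_circleTwist_le hι hρι hρu hβ U a x i j R T
  -- Haar substitution and Fubini
  have hZ : 0 < ∫ U, w U ∂πG := integral_exp_neg_mul_wilsonAction_pos ρ hρ β
  have hwint : Integrable (fun U => B * ∫ ζ, w (circleTwist ι ζ U) ∂πU) πG :=
    (integrable_integral_circleTwist' hιc hwc).const_mul B
  rw [wilsonExpectation_eq_integral_div ρ hρ β X]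
  change |(∫ U, X U * w U ∂πG) / ∫ U, w U ∂πG| ≤ _
  rw [abs_div, abs_of_pos hZ, div_le_iff₀ hZ]
  calc |∫ U, X U * w U ∂πG|
      = |∫ U, (∫ ζ, X (circleTwist ι ζ U) * w (circleTwist ι ζ U) ∂πU) ∂πG| := by
        rw [integral_eq_integral_integral_circleTwist ι hιc hXwc]
    _ ≤ ∫ U, |∫ ζ, X (circleTwist ι ζ U) * w (circleTwist ι ζ U) ∂πU| ∂πG := abs_integral_le_integral_abs
    _ ≤ ∫ U, B * ∫ ζ, w (circleTwist ι ζ U) ∂πU ∂πG :=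
        integral_mono_of_nonneg (ae_of_all _ fun U => abs_nonneg _) hwint (ae_of_all _ hpt)
    _ = B * ∫ U, w U ∂πG := by
        rw [integral_const_mul, ← integral_eq_integral_integral_circleTwist ι hιc hwc]
    _ ≤ _ := mul_le_mul_of_nonneg_right hBle hZ.le

/-- The arithmetic of the rotation parameter: with `δ = min(1, 1/(945 nβ))` and `R ≥ 1`,
`−Tδ log(R+1) + nβ · 189 T δ² (1 + log(R+1)) ≤ −T log(R+1) / (1890 (1 + nβ))`. [folklore] -/
private theorem exponent_le' (hn : 1 ≤ n) {β : ℝ} (hβ : 0 < β) {R : ℕ} (hR : 1 ≤ R) (T : ℕ) :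
    -((T : ℝ) * (min 1 (1 / (945 * (n * β))) * Real.log (R + 1))) +
        n * β * (189 * T * (min 1 (1 / (945 * (n * β)))) ^ 2 * (1 + Real.log (R + 1))) ≤
      -(1 / 1890) * T * Real.log (R + 1) / (1 + n * β) := by
  set δ : ℝ := min 1 (1 / (945 * (n * β))) with hδ
  set Lg : ℝ := Real.log (R + 1) with hL
  have hnb : 0 < (n : ℝ) * β := mul_pos (by exact_mod_cast hn) hβ
  have hδ0 : 0 < δ := lt_min one_pos (by positivity)
  have hδ1 : δ ≤ 1 := min_le_left _ _
  have hδ2 : δ ≤ 1 / (945 * (n * β)) := min_le_right _ _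
  have hL2 : Real.log 2 ≤ Lg := by
    have h1R : (1 : ℝ) ≤ R := by exact_mod_cast hR
    rw [hL]; exact Real.log_le_log two_pos (by linarith)
  have hlog2 : (0.6931471803 : ℝ) < Real.log 2 := Real.log_two_gt_d9
  have hL0 : 0 < Lg := by linarith
  have hT : (0 : ℝ) ≤ T := Nat.cast_nonneg T
  have h1L : 1 + Lg ≤ 5 / 2 * Lg := by linarith
  have hnbδ : n * β * δ ≤ 1 / 945 := by
    calc n * β * δ ≤ n * β * (1 / (945 * (n * β))) := mul_le_mul_of_nonneg_left hδ2 hnb.le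
      _ = 1 / 945 := by field_simp
  have hcost : n * β * (189 * T * δ ^ 2 * (1 + Lg)) ≤ T * δ * Lg / 2 := by
    have h2 : n * β * (189 * T * δ ^ 2 * (1 + Lg)) ≤ n * β * (189 * T * δ ^ 2 * (5 / 2 * Lg)) := by
      gcongr
    refine h2.trans ?_
    have h3 : n * β * (189 * T * δ ^ 2 * (5 / 2 * Lg)) = (n * β * δ) * (945 / 2) * (T * δ * Lg) := by
      ring
    rw [h3]
    have h4 : (n * β * δ) * (945 / 2) ≤ 1 / 2 := by nlinarith
    have h5 : 0 ≤ T * δ * Lg := by positivity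
    nlinarith
  have hδlow : 1 / (945 * (1 + n * β)) ≤ δ := by
    rw [hδ]
    refine le_min ?_ ?_
    · rw [div_le_one (by positivity)]; nlinarith
    · exact one_div_le_one_div_of_le (by positivity) (by nlinarith)
  have hmain : -(T * (δ * Lg)) + n * β * (189 * T * δ ^ 2 * (1 + Lg)) ≤ -(T * δ * Lg / 2) := by
    nlinarith
  refine hmain.trans ?_
  rw [show -(1 / 1890 : ℝ) * T * Lg / (1 + n * β) = -(T * Lg * (1 / (945 * (1 + n * β))) / 2) by
    field_simp; ring]
  have : T * Lg * (1 / (945 * (1 + n * β))) ≤ T * Lg * δ :=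
    mul_le_mul_of_nonneg_left hδlow (by positivity)
  linarith

/-- **LOGARITHMIC CONFINEMENT FROM THE CENTRAL CIRCLE IN `d = 3`, TORUS STATES** (Glimm–Jaffe 1977;
Fröhlich 1979 Cor. 2; Chatterjee 2026 Thm 3.1 — periodic-boundary form, uniformly in the volume).
Let `G` be a compact second-countable group, `ρ` a continuous representation on `ℂⁿ`, `n ≥ 1`, with
unitary values, `ι : U(1) → G` a continuous homomorphism into the centre with `ρ(ι(z)) = z·1` (e.g.
`G = U(n)`, `ρ` fundamental). Then for every `β > 0`, every three-dimensional torus `(ℤ/Lℤ)³`, base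
point, plane `i ≠ j` and side lengths `1 ≤ R`, `T` with `4(R+T+1) ≤ L`:
`|⟨W_{R×T}⟩_{G,ρ,β,L}| ≤ exp(−T·log(R+1) / (1890 (1 + nβ)))`.
HONEST FRAMING: `d = 3` and a central `U(1)` only; a logarithmic (not linear) confining bound; silent
about `d = 4` and about the mass gap. [cite: Chatterjee2026CentralU1, Thm 3.1] [cite: GlimmJaffe1977QuarkTrapping, main theorem] -/
theorem abs_wilsonExpectation_wilsonLoop_le_logConfinement_d3 (hρ : Continuous ρ)
    (hρu : ∀ g, ρ g ∈ Matrix.unitaryGroup (Fin n) ℂ) (hιc : Continuous ι)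
    (hι : ∀ z, ι z ∈ Subgroup.center G)
    (hρι : ∀ z, ρ (ι z) = (z : ℂ) • (1 : Matrix (Fin n) (Fin n) ℂ)) (hn : 1 ≤ n) {β : ℝ} (hβ : 0 < β)
    (x : Site 3 L) {i j : Fin 3} (hij : i ≠ j) {R T : ℕ} (hR : 1 ≤ R) (hL : 4 * (R + T + 1) ≤ L) :
    |wilsonExpectation ρ β (wilsonLoop ρ x i j R T)| ≤
      Real.exp (-(1 / 1890) * T * Real.log (R + 1) / (1 + n * β)) := by
  set δ : ℝ := min 1 (1 / (945 * (n * β))) with hδ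
  have hδ0 : 0 ≤ δ := le_min zero_le_one (by positivity)
  have hδ1 : δ ≤ 1 := min_le_left _ _
  refine (abs_wilsonExpectation_wilsonLoop_le_exp_d3_torus hρ hρu hιc hι hρι hβ.le x hij hL hδ0 hδ1).trans ?_
  rw [Real.exp_le_exp]
  have := exponent_le' hn hβ hR T
  rw [hδ]
  refine (le_of_eq ?_).trans (this.trans (le_of_eq ?_))
  · ring
  · ring

end Assembly

end CentralCircleTorus

/-! ### 5. The unitary groups `U(n)` and `U(1)` on the torus -/

section Unitary

open CentralCircleTorus

variable {L : ℕ} [NeZero L]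

/-- The scalar circle is central in `U(n)`. [folklore] -/
private theorem scalarUnitaryHom_mem_center' {n : ℕ} (z : Circle) :
    (scalarUnitaryHom z : Matrix.unitaryGroup (Fin n) ℂ) ∈
      Subgroup.center (Matrix.unitaryGroup (Fin n) ℂ) := by
  rw [Subgroup.mem_center_iff]
  intro g
  apply Subtype.ext
  simp only [Submonoid.coe_mul, scalarUnitaryHom_apply, coe_scalarUnitary, Matrix.mul_smul,
    Matrix.mul_one, Matrix.smul_mul, Matrix.one_mul]

/-- `U(n) ⊆ M_n(ℂ)` is second countable. [folklore] -/
private theorem secondCountableTopology_unitaryGroup' {n : ℕ} :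
    SecondCountableTopology (Matrix.unitaryGroup (Fin n) ℂ) := by
  haveI : SecondCountableTopology (Matrix (Fin n) (Fin n) ℂ) :=
    inferInstanceAs (SecondCountableTopology (Fin n → Fin n → ℂ))
  exact TopologicalSpace.Subtype.secondCountableTopology (α := Matrix (Fin n) (Fin n) ℂ) _

/-- **`U(n)` lattice gauge theory in three dimensions, torus states: logarithmic confinement at
every coupling** (Chatterjee 2026 Thm 3.1, «This class includes `U(n)` itself»; Fröhlich 1979
Cor. 2; torus form, uniform in `L ≥ 4(R+T+1)`):
`|⟨W_{R×T}⟩_{U(n),β,L}| ≤ exp(−T·log(R+1)/(1890(1+nβ)))` for `n ≥ 1`, `β > 0`, `1 ≤ R`. [cite: Chatterjee2026CentralU1, Thm 3.1] -/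
theorem unitaryGroup_wilsonLoop_logConfinement_d3_torus {n : ℕ} (hn : 1 ≤ n) {β : ℝ} (hβ : 0 < β)
    (x : Site 3 L) {i j : Fin 3} (hij : i ≠ j) {R T : ℕ} (hR : 1 ≤ R) (hL : 4 * (R + T + 1) ≤ L) :
    |wilsonExpectation (unitaryFundamentalRep (Fin n) ℂ) β
        (wilsonLoop (unitaryFundamentalRep (Fin n) ℂ) x i j R T)| ≤
      Real.exp (-(1 / 1890) * T * Real.log (R + 1) / (1 + n * β)) := by
  haveI := secondCountableTopology_unitaryGroup' (n := n)
  exact abs_wilsonExpectation_wilsonLoop_le_logConfinement_d3 (ρ := unitaryFundamentalRep (Fin n) ℂ)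
    (ι := scalarUnitaryHom) continuous_subtype_val (fun g => g.2) continuous_scalarUnitaryHom
    scalarUnitaryHom_mem_center' (fun z => rfl) hn hβ x hij hR hL

/-- **Glimm–Jaffe 1977 on the torus**: three-dimensional `U(1)` lattice gauge theory (Wilson action,
periodic boundary conditions) has logarithmically confined Wilson loops at every coupling:
`|⟨cos θ_{∂(R×T)}⟩_{U(1),β,L}| ≤ exp(−T·log(R+1)/(1890(1+β)))` for `β > 0`, `1 ≤ R`,
`4(R+T+1) ≤ L`. [cite: GlimmJaffe1977QuarkTrapping, main theorem] -/
theorem u1_wilsonLoop_logConfinement_d3_torus {β : ℝ} (hβ : 0 < β) (x : Site 3 L) {i j : Fin 3}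
    (hij : i ≠ j) {R T : ℕ} (hR : 1 ≤ R) (hL : 4 * (R + T + 1) ≤ L) :
    |wilsonExpectation (L := L) u1Rep β (wilsonLoop u1Rep x i j R T)| ≤
      Real.exp (-(1 / 1890) * T * Real.log (R + 1) / (1 + β)) := by
  have hρι : ∀ z : Circle, u1Rep (MonoidHom.id Circle z) = (z : ℂ) • (1 : Matrix (Fin 1) (Fin 1) ℂ) :=
    fun z => by
      rw [MonoidHom.id_apply, u1Rep_apply, Matrix.scalar_apply, Matrix.smul_one_eq_diagonal]
  have h := abs_wilsonExpectation_wilsonLoop_le_logConfinement_d3 (L := L) (ρ := u1Rep)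
    (ι := MonoidHom.id Circle) continuous_u1Rep u1Rep_mem_unitaryGroup continuous_id
    (fun z => Subgroup.mem_center_iff.2 fun g => mul_comm g z) hρι le_rfl hβ x hij hR hL
  simpa using h

end Unitary

/-! ### 6. The static potential of the infinite-volume limit states grows at least logarithmically -/

section StaticPotentialLog

open Literature.MathematicalPhysics.QuantumLattice CentralCircleTorus

variable {n : ℕ} {G : Type*} [Group G] [TopologicalSpace G] [IsTopologicalGroup G] [CompactSpace G]
  [MeasurableSpace G] [BorelSpace G] [SecondCountableTopology G]
  {ρ : G →* Matrix (Fin n) (Fin n) ℂ} {ι : Circle →* G}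

/-- **The static quark potential grows at least logarithmically** (`d = 3`, central `U(1)` acting
by scalars in `ρ`; Chatterjee 2026 §2: «the theory confines if there exists `V(R) → ∞` with
`⟨W_ℓ⟩ ≤ C e^{−V(R)T}`», Thm 3.1: `V(R) ≥ C log(R+1)/(1+nβ)`): for every `β > 0`, every
infinite-volume limit point `μ` of the torus Wilson states (`infiniteVolumeLimitPoints ρ β`) with
non-vanishing loops, and every `R ≥ 1`, the tree's static potential
`V_μ(R) = lim_T −T⁻¹ log W_μ(R × T)` (`staticPotential`, Bachas / Seiler) satisfies
`log(R+1) / (1890 (1+nβ)) ≤ V_μ(R)` — from the volume-uniform torus bound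
`abs_wilsonExpectation_wilsonLoop_le_logConfinement_d3` passed to the limit point
(`abs_rectExpectation_le_of_eventually`). [cite: Chatterjee2026CentralU1, §2 and Thm 3.1] -/
theorem log_le_staticPotential_d3 (hρ : Continuous ρ) (hρu : ∀ g, ρ g ∈ Matrix.unitaryGroup (Fin n) ℂ)
    (hιc : Continuous ι) (hι : ∀ z, ι z ∈ Subgroup.center G)
    (hρι : ∀ z, ρ (ι z) = (z : ℂ) • (1 : Matrix (Fin n) (Fin n) ℂ)) (hn : 1 ≤ n) {β : ℝ} (hβ : 0 < β)
    {μ : Measure (LGConfig 3 G)} (hμ : μ ∈ infiniteVolumeLimitPoints ρ β)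
    (hW : ∀ R T, 1 ≤ R → 1 ≤ T →
      rectExpectation μ (fun g => normalisedCharacter n (ρ g)) 0 1 R T ≠ 0)
    {R : ℕ} (hR : 1 ≤ R) :
    (1 / 1890) * Real.log (R + 1) / (1 + n * β) ≤
      staticPotential μ (fun g => normalisedCharacter n (ρ g)) R := by
  have h01 : (0 : Fin 3) ≠ 1 := by decide
  have hpos := StaticPotential.rectExpectation_pos ρ (by norm_num : 2 ≤ 3) hρ hβ.le hμ hW
  have hlim := StaticPotential.tendsto_neg_log_div_staticPotential ρ (by norm_num : 2 ≤ 3) hρ hβ.le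
    hμ hW R
  -- the torus bound passes to the limit point, for every `T`
  have hbd : ∀ T : ℕ, |rectExpectation μ (fun g => normalisedCharacter n (ρ g)) 0 1 R T| ≤
      Real.exp (-(1 / 1890) * T * Real.log (R + 1) / (1 + n * β)) := by
    intro T
    refine abs_rectExpectation_le_of_eventually ρ hρ hμ ?_
    filter_upwards [eventually_ge_atTop (4 * (R + T + 1))] with L hL
    exact abs_wilsonExpectation_wilsonLoop_le_logConfinement_d3 hρ hρu hιc hι hρι hn hβ
      (0 : Site 3 (L + 1)) h01 hR (by omega)
  refine ge_of_tendsto hlim ?_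
  filter_upwards [eventually_ge_atTop 1] with T hT
  have hWpos := hpos R T
  have hle : rectExpectation μ (fun g => normalisedCharacter n (ρ g)) 0 1 R T ≤
      Real.exp (-(1 / 1890) * T * Real.log (R + 1) / (1 + n * β)) := (le_abs_self _).trans (hbd T)
  have hlog : Real.log (rectExpectation μ (fun g => normalisedCharacter n (ρ g)) 0 1 R T) ≤
      -(1 / 1890) * T * Real.log (R + 1) / (1 + n * β) := by
    rw [← Real.log_exp (-(1 / 1890) * T * Real.log (R + 1) / (1 + n * β))]
    exact Real.log_le_log hWpos hle
  have hT' : (0 : ℝ) < T := by exact_mod_cast hT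
  rw [le_div_iff₀ hT']
  have : (1 / 1890) * Real.log (R + 1) / (1 + n * β) * T =
      -(-(1 / 1890) * T * Real.log (R + 1) / (1 + n * β)) := by ring
  linarith

/-- **Confinement of static charges in the sense `V(R) → ∞`** (`d = 3`, central `U(1)`; Chatterjee
2026 §2 / Thm 3.1): the static potential of every infinite-volume limit point with non-vanishing
loops diverges (at least logarithmically) as `R → ∞`. HONEST FRAMING: logarithmic growth, not a
string tension (`σ > 0` needs Göpfert–Mack); `d = 3` only. [cite: Chatterjee2026CentralU1, §2 and Thm 3.1] -/
theorem tendsto_staticPotential_atTop_d3 (hρ : Continuous ρ)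
    (hρu : ∀ g, ρ g ∈ Matrix.unitaryGroup (Fin n) ℂ) (hιc : Continuous ι)
    (hι : ∀ z, ι z ∈ Subgroup.center G)
    (hρι : ∀ z, ρ (ι z) = (z : ℂ) • (1 : Matrix (Fin n) (Fin n) ℂ)) (hn : 1 ≤ n) {β : ℝ} (hβ : 0 < β)
    {μ : Measure (LGConfig 3 G)} (hμ : μ ∈ infiniteVolumeLimitPoints ρ β)
    (hW : ∀ R T, 1 ≤ R → 1 ≤ T →
      rectExpectation μ (fun g => normalisedCharacter n (ρ g)) 0 1 R T ≠ 0) :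
    Tendsto (fun R : ℕ => staticPotential μ (fun g => normalisedCharacter n (ρ g)) R) atTop atTop := by
  refine tendsto_atTop_mono' atTop ?_ (tendsto_log_potential_atTop (C := 1 / 1890) (by norm_num) n hβ)
  filter_upwards [eventually_ge_atTop 1] with R hR
  exact log_le_staticPotential_d3 hρ hρu hιc hι hρι hn hβ hμ hW hR

/-- **`U(n)₃`: the static potential of every infinite-volume limit state grows at least like
`log(R+1)/(1890(1+nβ))`** (Chatterjee 2026 Thm 3.1 for `U(n)`, in the tree's static-potential
currency). [cite: Chatterjee2026CentralU1, Thm 3.1] -/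
theorem unitaryGroup_log_le_staticPotential_d3 {n : ℕ} (hn : 1 ≤ n) {β : ℝ} (hβ : 0 < β)
    {μ : Measure (LGConfig 3 (Matrix.unitaryGroup (Fin n) ℂ))}
    (hμ : μ ∈ infiniteVolumeLimitPoints (unitaryFundamentalRep (Fin n) ℂ) β)
    (hW : ∀ R T, 1 ≤ R → 1 ≤ T →
      rectExpectation μ (fun g => normalisedCharacter n (unitaryFundamentalRep (Fin n) ℂ g)) 0 1 R T ≠ 0)
    {R : ℕ} (hR : 1 ≤ R) :
    (1 / 1890) * Real.log (R + 1) / (1 + n * β) ≤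
      staticPotential μ (fun g => normalisedCharacter n (unitaryFundamentalRep (Fin n) ℂ g)) R := by
  haveI := secondCountableTopology_unitaryGroup' (n := n)
  exact log_le_staticPotential_d3 (ρ := unitaryFundamentalRep (Fin n) ℂ) (ι := scalarUnitaryHom)
    continuous_subtype_val (fun g => g.2) continuous_scalarUnitaryHom scalarUnitaryHom_mem_center'
    (fun z => rfl) hn hβ hμ hW hR

end StaticPotentialLog

/-! ### 7. `U(1)₃`: Glimm–Jaffe's logarithmic static potential -/

section U1StaticPotential

open Literature.MathematicalPhysics.QuantumLattice CentralCircleTorus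

/-- **Glimm–Jaffe 1977: the static potential of three-dimensional compact QED grows at least
logarithmically** — for every `β > 0`, every infinite-volume limit point `μ` of the `U(1)₃` torus
Wilson states with non-vanishing loops and every `R ≥ 1`,
`log(R+1)/(1890(1+β)) ≤ V_μ(R)`; in particular `V_μ(R) → ∞` («quark trapping»).
[cite: GlimmJaffe1977QuarkTrapping, main theorem] [cite: Chatterjee2026CentralU1, §2 and Thm 3.1] -/
theorem u1_log_le_staticPotential_d3 {β : ℝ} (hβ : 0 < β) {μ : Measure (LGConfig 3 Circle)}
    (hμ : μ ∈ infiniteVolumeLimitPoints u1Rep β)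
    (hW : ∀ R T, 1 ≤ R → 1 ≤ T →
      rectExpectation μ (fun g => normalisedCharacter 1 (u1Rep g)) 0 1 R T ≠ 0)
    {R : ℕ} (hR : 1 ≤ R) :
    (1 / 1890) * Real.log (R + 1) / (1 + β) ≤
      staticPotential μ (fun g => normalisedCharacter 1 (u1Rep g)) R := by
  have hρι : ∀ z : Circle, u1Rep (MonoidHom.id Circle z) = (z : ℂ) • (1 : Matrix (Fin 1) (Fin 1) ℂ) :=
    fun z => by
      rw [MonoidHom.id_apply, u1Rep_apply, Matrix.scalar_apply, Matrix.smul_one_eq_diagonal]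
  have h := log_le_staticPotential_d3 (ρ := u1Rep) (ι := MonoidHom.id Circle) continuous_u1Rep
    u1Rep_mem_unitaryGroup continuous_id (fun z => Subgroup.mem_center_iff.2 fun g => mul_comm g z)
    hρι le_rfl hβ hμ hW hR
  simpa using h

/-- **`U(1)₃` traps static charges**: `V_μ(R) → ∞` as `R → ∞` for every `β > 0` and every
infinite-volume limit point with non-vanishing loops (Glimm–Jaffe 1977). [cite: GlimmJaffe1977QuarkTrapping, main theorem] -/
theorem u1_tendsto_staticPotential_atTop_d3 {β : ℝ} (hβ : 0 < β) {μ : Measure (LGConfig 3 Circle)}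
    (hμ : μ ∈ infiniteVolumeLimitPoints u1Rep β)
    (hW : ∀ R T, 1 ≤ R → 1 ≤ T →
      rectExpectation μ (fun g => normalisedCharacter 1 (u1Rep g)) 0 1 R T ≠ 0) :
    Tendsto (fun R : ℕ => staticPotential μ (fun g => normalisedCharacter 1 (u1Rep g)) R)
      atTop atTop := by
  have hρι : ∀ z : Circle, u1Rep (MonoidHom.id Circle z) = (z : ℂ) • (1 : Matrix (Fin 1) (Fin 1) ℂ) :=
    fun z => by
      rw [MonoidHom.id_apply, u1Rep_apply, Matrix.scalar_apply, Matrix.smul_one_eq_diagonal]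
  exact tendsto_staticPotential_atTop_d3 (ρ := u1Rep) (ι := MonoidHom.id Circle) continuous_u1Rep
    u1Rep_mem_unitaryGroup continuous_id (fun z => Subgroup.mem_center_iff.2 fun g => mul_comm g z)
    hρι le_rfl hβ hμ hW

end U1StaticPotential

end Literature.MathematicalPhysics.QuantumFieldTheory

end
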